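import Summits.AnomalousDissipation.AnomalousDissipation.Theorems.MarginalStabilityChainStretchedVortexRowsStubBraidExitCell

/-!
# Tools for the stub `stub_braidExit` (r4; line `braid-closed-large-circulation-gluing`, crux
# stmt-AnomalousDissipation-3009), part E: real-variable bounds for the damped corrector

With `A = cos a`, `Sa = sin a`, `B = cosh b`, `Sb = sinh b`, `D = B − A`, `E = B + A`, `Z = 10 + D`,
`hv = 100/Z² = W₀(log D)`, `W₁ = −200D/Z³ = W₀′(log D)`, `W₂ = −200D(10 − 2D)/Z⁴ = W₀″(log D)`
(`W₀ = decayProfile`, part D) and `τ = 4πν/L ≤ 4/5` (from `ν ≤ r² ≤ L²/16`, `L ≤ 1`), the corrector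
part of the Leibniz-expanded operator of `φ = M(G(log D) + κ(L/π)·S·W₀(log D) + c₀)`, fed with the
closed forms of parts A/B, regroups (`corrector_regroup`, using `trig_key`:
`cos a sinh²b − sin²a cosh b = −E·D + E(B − 1)(1 + A)`) into
`κ·[hv(−E + E(B−1)(1+A)/D) − (L/π)hv b Sa B − 200τ Sa Sb E(10−2D)/Z⁴ + 200(L/π)Sa Sb² b/Z³ − 400τ Sa Sb E/Z³]`.

* `corrector_far_bound` (`far_p1 … far_p5`): the bracket is `≤ 200` at EVERY point (`|b| ≤ cosh b`,
  `|sinh b| ≤ cosh b`): the damping `(10/(10+D))²` makes every corrector term bounded, so the radial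
  layer's `−G′ b tanh(b/2)` wins for `|b| ≥ 1/4` once `κ ≤ 10⁻⁵` (registered def-free form
  `stub_braidExit_farBound`);
* `strip_bound` (`strip_q1 … strip_q5`): in the strip `|b| ≤ 1/4` (encoded `cosh b ≤ 26/25`,
  `|sinh b| ≤ 13/50`, `b²/2 ≤ cosh b − 1 ≤ b sinh b/2`) the radial part `νc²(E/D)G″ − G′ b Sb/D`
  plus `κ`·bracket is `≤ −(κ/3)E` for `G′ ≥ 1/2`, `0 ≤ κ ≤ 1/10` — the cell-layer mechanism of part C
  for the damped corrector (`hv ≥ 0.68`, positive junk `≤ 0.46 hv E + 2.08 bSb/D`).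
-/

-- `Summit.<Summit>.<Problem>` is the mandated summit-side namespace (CONVENTIONS §2): duplicate deliberate.
set_option linter.dupNamespace false

noncomputable section

open scoped Topology
open Filter Set

namespace Summit.AnomalousDissipation.AnomalousDissipation.Theorems.MarginalStabilityChainStretchedVortexRows.BraidExit

open Literature.Analysis.FluidPDE Literature.Analysis.FluidPDE.StretchedLayer

/-! ### Real-variable bounds for the corrector terms -/

/-- `cos a sinh²b − sin²a cosh b = −E·D + E(cosh b − 1)(1 + cos a)` in abstract variables. [folklore] -/
theorem trig_key {A Sa B Sb D E : ℝ} (hSa : Sa ^ 2 + A ^ 2 = 1) (hSb : Sb ^ 2 = B ^ 2 - 1)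
    (hD : D = B - A) (hE : E = B + A) :
    A * Sb ^ 2 - Sa ^ 2 * B = -(E * D) + E * ((B - 1) * (1 + A)) := by
  subst hD hE
  linear_combination A * hSb - B * hSa

/-- The corrector part of the expanded operator, regrouped: with `Z = 10 + D`, `hv = 100/Z²`,
`W₁ = −200D/Z³`, `W₂ = −200D(10 − 2D)/Z⁴` (values of `W₀, W₀′, W₀″` at `log D`) and `τ = 4πν/L`,
`(L/π)[hv·𝒜S + S·𝒜W + 2ν ∇S·∇W] = hv(−E + E(B−1)(1+A)/D) − (L/π)hv b Sa B − 200τ Sa Sb E(10−2D)/Z⁴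
 + 200(L/π) Sa Sb² b/Z³ − 400 τ Sa Sb E/Z³`. [folklore] -/
theorem corrector_regroup {L ν c b A Sa B Sb D E Z hv W₁ W₂ Tg Th Xg Yg Xh Yh : ℝ}
    (hL : 0 < L) (hc : c = 2 * Real.pi / L) (hSa : Sa ^ 2 + A ^ 2 = 1) (hSb : Sb ^ 2 = B ^ 2 - 1)
    (hD : D = B - A) (hE : E = B + A) (hDpos : 0 < D) (hZ : Z = 10 + D) (hhv : hv = 100 / Z ^ 2)
    (hW₁ : W₁ = -200 * D / Z ^ 3) (hW₂ : W₂ = -200 * D * (10 - 2 * D) / Z ^ 4)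
    (hTg : Tg = Real.pi / L * (A * Sb ^ 2 - Sa ^ 2 * B) / D - b * Sa * B)
    (hTh : Th = ν * c ^ 2 * (E / D) * W₂ - W₁ * (b * Sb / D))
    (hXg : Xg = c * A * Sb) (hYg : Yg = c * Sa * B) (hXh : Xh = W₁ * (c * Sa / D))
    (hYh : Yh = W₁ * (c * Sb / D)) :
    L / Real.pi * (hv * Tg + Sa * Sb * Th + 2 * ν * (Xg * Xh + Yg * Yh)) =
      hv * (-E + E * ((B - 1) * (1 + A)) / D) - L / Real.pi * hv * b * Sa * B -
        200 * (4 * Real.pi * ν / L) * Sa * Sb * E * (10 - 2 * D) / Z ^ 4 +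
        200 * (L / Real.pi) * Sa * Sb ^ 2 * b / Z ^ 3 -
        400 * (4 * Real.pi * ν / L) * Sa * Sb * E / Z ^ 3 := by
  have hπ := Real.pi_pos
  have hZpos : 0 < Z := by rw [hZ, hD]; linarith
  have hkey := trig_key hSa hSb hD hE
  subst hE hD hZ hhv hW₁ hW₂ hTg hTh hXg hYg hXh hYh hc
  rw [hkey]
  field_simp
  ring

/-- Far piece 1: `hv(−E + E(B−1)(1+A)/D) ≤ 10`. [folklore] -/
theorem far_p1 {A B D E Z hv : ℝ} (hA1 : A ≤ 1) (hA2 : -1 ≤ A) (hB : 1 ≤ B) (hD : D = B - A)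
    (hE : E = B + A) (hDpos : 0 < D) (hZ : Z = 10 + D) (hhv : hv = 100 / Z ^ 2) :
    hv * (-E + E * ((B - 1) * (1 + A)) / D) ≤ 10 := by
  have hE0 : 0 ≤ E := by rw [hE]; linarith
  have hZ0 : 0 < Z := by rw [hZ]; linarith
  have hv0 : 0 ≤ hv := by rw [hhv]; positivity
  have h1 : E * ((B - 1) * (1 + A)) / D ≤ E * (1 + A) := by
    rw [div_le_iff₀ hDpos, hD]
    nlinarith [mul_nonneg (mul_nonneg hE0 (by linarith : (0:ℝ) ≤ 1 + A)) (by linarith : (0:ℝ) ≤ 1 - A)]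
  have h2 : -E + E * ((B - 1) * (1 + A)) / D ≤ Z := by
    have h3 : E * (1 + A) - E ≤ Z := by
      rw [hZ, hD, hE]; nlinarith [mul_le_mul_of_nonneg_left hA1 hE0]
    linarith
  calc hv * (-E + E * ((B - 1) * (1 + A)) / D) ≤ hv * Z := mul_le_mul_of_nonneg_left h2 hv0
    _ = 100 / Z := by rw [hhv]; field_simp
    _ ≤ 10 := by rw [div_le_iff₀ hZ0]; linarith

/-- Far piece 2: `|(L/π) hv b Sa B| ≤ 34`. [folklore] -/
theorem far_p2 {L b Sa B Z hv : ℝ} (hL : 0 < L) (hL1 : L ≤ 1) (hSa1 : |Sa| ≤ 1) (hB0 : 0 ≤ B)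
    (hbB : |b| ≤ B) (hBZ : B ≤ Z) (hZ0 : 0 < Z) (hhv : hv = 100 / Z ^ 2) :
    -(L / Real.pi * hv * b * Sa * B) ≤ 34 := by
  have hπ := Real.pi_pos
  have hπ3 : 3.14 < Real.pi := Real.pi_gt_d2
  have hv0 : 0 ≤ hv := by rw [hhv]; positivity
  have hvZZ : hv * Z ^ 2 = 100 := by rw [hhv]; field_simp
  have h1 : |b * Sa * B| ≤ Z * 1 * Z := by
    rw [abs_mul, abs_mul, abs_of_nonneg hB0]
    exact mul_le_mul (mul_le_mul (hbB.trans hBZ) hSa1 (abs_nonneg _) hZ0.le) hBZ hB0 (by positivity)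
  have h2 : L / Real.pi * hv ≤ 1 / 3 * hv := by
    apply mul_le_mul_of_nonneg_right _ hv0
    rw [div_le_iff₀ hπ]; linarith
  have h3 : L / Real.pi * hv * |b * Sa * B| ≤ 1 / 3 * hv * (Z * 1 * Z) :=
    mul_le_mul h2 h1 (abs_nonneg _) (by positivity)
  calc -(L / Real.pi * hv * b * Sa * B) ≤ |L / Real.pi * hv * b * Sa * B| := neg_le_abs _
    _ = L / Real.pi * hv * |b * Sa * B| := by
      rw [show L / Real.pi * hv * b * Sa * B = (L / Real.pi * hv) * (b * Sa * B) by ring, abs_mul,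
        abs_of_nonneg (by positivity)]
    _ ≤ 1 / 3 * hv * (Z * 1 * Z) := h3
    _ = 100 / 3 := by linear_combination (1 / 3 : ℝ) * hvZZ
    _ ≤ 34 := by norm_num

/-- Far piece 3: `|200 τ Sa Sb E (10 − 2D)/Z⁴| ≤ 32`. [folklore] -/
theorem far_p3 {τ Sa Sb D E Z : ℝ} (hτ0 : 0 ≤ τ) (hτ : τ ≤ 4 / 5) (hSa1 : |Sa| ≤ 1) (hSbZ : |Sb| ≤ Z)
    (hE0 : 0 ≤ E) (hEZ : E ≤ Z) (hD0 : 0 ≤ D) (hZ : Z = 10 + D) :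
    -(200 * τ * Sa * Sb * E * (10 - 2 * D) / Z ^ 4) ≤ 32 := by
  have hZ0 : 0 < Z := by rw [hZ]; linarith
  have h1 : |Sa * Sb * E * (10 - 2 * D)| ≤ 1 * Z * Z * (2 * Z) := by
    rw [abs_mul, abs_mul, abs_mul, abs_of_nonneg hE0]
    refine mul_le_mul (mul_le_mul (mul_le_mul hSa1 hSbZ (abs_nonneg _) zero_le_one)
      hEZ hE0 (by positivity)) ?_ (abs_nonneg _) (by positivity)
    rw [abs_le]; constructor <;> nlinarith
  have h2 : 200 * τ * |Sa * Sb * E * (10 - 2 * D)| ≤ 160 * (1 * Z * Z * (2 * Z)) :=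
    mul_le_mul (by linarith) h1 (abs_nonneg _) (by norm_num)
  calc -(200 * τ * Sa * Sb * E * (10 - 2 * D) / Z ^ 4)
      ≤ |200 * τ * Sa * Sb * E * (10 - 2 * D) / Z ^ 4| := neg_le_abs _
    _ = 200 * τ * |Sa * Sb * E * (10 - 2 * D)| / Z ^ 4 := by
      rw [abs_div, abs_of_pos (by positivity : (0:ℝ) < Z ^ 4),
        show 200 * τ * Sa * Sb * E * (10 - 2 * D) = (200 * τ) * (Sa * Sb * E * (10 - 2 * D)) by ring,
        abs_mul, abs_of_nonneg (by positivity)]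
    _ ≤ 160 * (1 * Z * Z * (2 * Z)) / Z ^ 4 := div_le_div_of_nonneg_right h2 (by positivity)
    _ = 320 / Z := by field_simp; ring
    _ ≤ 32 := by rw [div_le_iff₀ hZ0]; linarith

/-- Far piece 4: `|200 (L/π) Sa Sb² b/Z³| ≤ 64`. [folklore] -/
theorem far_p4 {L b Sa Sb B Z : ℝ} (hL : 0 < L) (hL1 : L ≤ 1) (hSa1 : |Sa| ≤ 1)
    (hSb : Sb ^ 2 = B ^ 2 - 1) (hB0 : 0 ≤ B) (hbB : |b| ≤ B) (hBZ : B ≤ Z) (hZ0 : 0 < Z) :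
    200 * (L / Real.pi) * Sa * Sb ^ 2 * b / Z ^ 3 ≤ 64 := by
  have hπ := Real.pi_pos
  have hπ3 : 3.14 < Real.pi := Real.pi_gt_d2
  have h1 : |Sa * Sb ^ 2 * b| ≤ 1 * Z ^ 2 * Z := by
    rw [abs_mul, abs_mul, abs_of_nonneg (sq_nonneg Sb)]
    refine mul_le_mul (mul_le_mul hSa1 ?_ (sq_nonneg _) zero_le_one) (hbB.trans hBZ)
      (abs_nonneg _) (by positivity)
    nlinarith
  have hLπ : L / Real.pi ≤ 32 / 100 := by rw [div_le_iff₀ hπ]; linarith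
  have h2 : 200 * (L / Real.pi) * |Sa * Sb ^ 2 * b| ≤ 64 * (1 * Z ^ 2 * Z) :=
    mul_le_mul (by linarith) h1 (abs_nonneg _) (by norm_num)
  calc 200 * (L / Real.pi) * Sa * Sb ^ 2 * b / Z ^ 3
      ≤ |200 * (L / Real.pi) * Sa * Sb ^ 2 * b / Z ^ 3| := le_abs_self _
    _ = 200 * (L / Real.pi) * |Sa * Sb ^ 2 * b| / Z ^ 3 := by
      rw [abs_div, abs_of_pos (by positivity : (0:ℝ) < Z ^ 3),
        show 200 * (L / Real.pi) * Sa * Sb ^ 2 * b = (200 * (L / Real.pi)) * (Sa * Sb ^ 2 * b) by ring,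
        abs_mul, abs_of_nonneg (by positivity)]
    _ ≤ 64 * (1 * Z ^ 2 * Z) / Z ^ 3 := div_le_div_of_nonneg_right h2 (by positivity)
    _ = 64 := by field_simp

/-- Far piece 5: `|400 τ Sa Sb E/Z³| ≤ 32`. [folklore] -/
theorem far_p5 {τ Sa Sb E Z : ℝ} (hτ0 : 0 ≤ τ) (hτ : τ ≤ 4 / 5) (hSa1 : |Sa| ≤ 1) (hSbZ : |Sb| ≤ Z)
    (hE0 : 0 ≤ E) (hEZ : E ≤ Z) (hZ10 : 10 ≤ Z) :
    -(400 * τ * Sa * Sb * E / Z ^ 3) ≤ 32 := by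
  have hZ0 : 0 < Z := by linarith
  have h1 : |Sa * Sb * E| ≤ 1 * Z * Z := by
    rw [abs_mul, abs_mul, abs_of_nonneg hE0]
    exact mul_le_mul (mul_le_mul hSa1 hSbZ (abs_nonneg _) zero_le_one) hEZ hE0 (by positivity)
  have h2 : 400 * τ * |Sa * Sb * E| ≤ 320 * (1 * Z * Z) :=
    mul_le_mul (by linarith) h1 (abs_nonneg _) (by norm_num)
  calc -(400 * τ * Sa * Sb * E / Z ^ 3) ≤ |400 * τ * Sa * Sb * E / Z ^ 3| := neg_le_abs _
    _ = 400 * τ * |Sa * Sb * E| / Z ^ 3 := by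
      rw [abs_div, abs_of_pos (by positivity : (0:ℝ) < Z ^ 3),
        show 400 * τ * Sa * Sb * E = (400 * τ) * (Sa * Sb * E) by ring, abs_mul,
        abs_of_nonneg (by positivity)]
    _ ≤ 320 * (1 * Z * Z) / Z ^ 3 := div_le_div_of_nonneg_right h2 (by positivity)
    _ = 320 / Z := by field_simp
    _ ≤ 32 := by rw [div_le_iff₀ hZ0]; linarith

/-- **Far bound**: the regrouped corrector part is `≤ 200` at every point (`B = cosh b ≥ 1`,
`|b| ≤ B`, `Sb² = B² − 1`, `Sa² + A² = 1`, `D = B − A > 0`, `4πν/L ≤ 4/5`, `L ≤ 1`). [folklore] -/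
theorem corrector_far_bound {L ν b A Sa B Sb D E Z hv : ℝ}
    (hL : 0 < L) (hL1 : L ≤ 1) (hν : 0 ≤ ν) (hτ : 4 * Real.pi * ν / L ≤ 4 / 5)
    (hSa : Sa ^ 2 + A ^ 2 = 1) (hSb : Sb ^ 2 = B ^ 2 - 1) (hB : 1 ≤ B) (hbB : |b| ≤ B)
    (hD : D = B - A) (hE : E = B + A) (hDpos : 0 < D) (hZ : Z = 10 + D) (hhv : hv = 100 / Z ^ 2) :
    hv * (-E + E * ((B - 1) * (1 + A)) / D) - L / Real.pi * hv * b * Sa * B -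
        200 * (4 * Real.pi * ν / L) * Sa * Sb * E * (10 - 2 * D) / Z ^ 4 +
        200 * (L / Real.pi) * Sa * Sb ^ 2 * b / Z ^ 3 -
        400 * (4 * Real.pi * ν / L) * Sa * Sb * E / Z ^ 3 ≤ 200 := by
  have hτ0 : 0 ≤ 4 * Real.pi * ν / L := by positivity
  have hA1 : A ≤ 1 := by nlinarith [sq_nonneg Sa, sq_nonneg (A - 1)]
  have hA2 : -1 ≤ A := by nlinarith [sq_nonneg Sa, sq_nonneg (A + 1)]
  have hSa1 : |Sa| ≤ 1 := by rw [← sq_le_one_iff_abs_le_one]; nlinarith [sq_nonneg A]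
  have hB0 : 0 ≤ B := by linarith
  have hSbB : |Sb| ≤ B := abs_le_of_sq_le_sq' (by nlinarith) hB0 |>.elim (fun h1 h2 => abs_le.2 ⟨h1, h2⟩)
  have hE0 : 0 ≤ E := by rw [hE]; linarith
  have hEZ : E ≤ Z := by rw [hE, hZ, hD]; linarith
  have hBZ : B ≤ Z := by rw [hZ, hD]; linarith
  have hZ10 : 10 ≤ Z := by rw [hZ]; linarith
  have hZ0 : 0 < Z := by linarith
  have p1 := far_p1 hA1 hA2 hB hD hE hDpos hZ hhv
  have p2 := far_p2 hL hL1 hSa1 hB0 hbB hBZ hZ0 hhv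
  have p3 := far_p3 hτ0 hτ hSa1 (hSbB.trans hBZ) hE0 hEZ hDpos.le hZ
  have p4 := far_p4 hL hL1 hSa1 hSb hB0 hbB hBZ hZ0
  have p5 := far_p5 hτ0 hτ hSa1 (hSbB.trans hBZ) hE0 hEZ hZ10
  linarith

/-! ### Strip bounds (`|b| ≤ 1/4`) -/

/-- Strip piece 1: `hv(−E + E(B−1)(1+A)/D) ≤ −hv E + (51/25)·bSb/D`. [folklore] -/
theorem strip_q1 {b A B Sb D E Z hv : ℝ} (hA1 : A ≤ 1) (hA2 : -1 ≤ A) (hB : 1 ≤ B) (hB1 : B ≤ 26 / 25)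
    (hD : D = B - A) (hE : E = B + A) (hDpos : 0 < D) (hZ : Z = 10 + D) (hhv : hv = 100 / Z ^ 2)
    (hβ : 0 ≤ b * Sb) (hB2 : B - 1 ≤ b * Sb / 2) :
    hv * (-E + E * ((B - 1) * (1 + A)) / D) ≤ -(hv * E) + 51 / 25 * (b * Sb / D) := by
  have hE0 : 0 ≤ E := by rw [hE]; linarith
  have hZ10 : 10 ≤ Z := by rw [hZ]; linarith
  have hv0 : 0 ≤ hv := by rw [hhv]; positivity
  have hv1 : hv ≤ 1 := by rw [hhv, div_le_one (by positivity)]; nlinarith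
  have h1 : E * ((B - 1) * (1 + A)) ≤ 51 / 25 * (b * Sb) := by
    have h2 : (B - 1) * (1 + A) ≤ b * Sb / 2 * 2 :=
      mul_le_mul hB2 (by linarith) (by linarith) (by linarith)
    have h3 : E ≤ 51 / 25 := by rw [hE]; linarith
    calc E * ((B - 1) * (1 + A)) ≤ E * (b * Sb / 2 * 2) := mul_le_mul_of_nonneg_left h2 hE0
      _ = E * (b * Sb) := by ring
      _ ≤ 51 / 25 * (b * Sb) := mul_le_mul_of_nonneg_right h3 hβ
  have h4 : E * ((B - 1) * (1 + A)) / D ≤ 51 / 25 * (b * Sb / D) := by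
    rw [mul_div_assoc']
    exact div_le_div_of_nonneg_right h1 hDpos.le
  have h5 : hv * (51 / 25 * (b * Sb / D)) ≤ 1 * (51 / 25 * (b * Sb / D)) :=
    mul_le_mul_of_nonneg_right hv1 (by positivity)
  nlinarith [mul_le_mul_of_nonneg_left h4 hv0]

/-- Strip piece 2: `|(L/π) hv b Sa B| ≤ hv E/3` (`|b Sa| ≤ (b² + Sa²)/2 ≤ E`, `B/π ≤ 1.04/3.14`).
[folklore] -/
theorem strip_q2 {L b A Sa B Z hv E : ℝ} (hL : 0 < L) (hL1 : L ≤ 1) (hSa : Sa ^ 2 + A ^ 2 = 1)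
    (hA2 : -1 ≤ A) (hB : 1 ≤ B) (hB1 : B ≤ 26 / 25) (hE : E = B + A) (hb2 : b ^ 2 / 2 ≤ B - 1)
    (hZ0 : 0 < Z) (hhv : hv = 100 / Z ^ 2) :
    -(L / Real.pi * hv * b * Sa * B) ≤ 1 / 3 * (hv * E) := by
  have hπ := Real.pi_pos
  have hπ3 : 3.14 < Real.pi := Real.pi_gt_d2
  have hv0 : 0 ≤ hv := by rw [hhv]; positivity
  have hE0 : 0 ≤ E := by rw [hE]; linarith
  have h1 : |b * Sa| ≤ E := by
    have hS2 : Sa ^ 2 ≤ 2 * (1 + A) := by nlinarith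
    rw [abs_le]; constructor <;> nlinarith [sq_nonneg (b + Sa), sq_nonneg (b - Sa)]
  have h2 : L / Real.pi * B ≤ 1 / 3 := by
    rw [div_mul_eq_mul_div, div_le_iff₀ hπ]; nlinarith
  calc -(L / Real.pi * hv * b * Sa * B) ≤ |L / Real.pi * hv * b * Sa * B| := neg_le_abs _
    _ = L / Real.pi * B * hv * |b * Sa| := by
      rw [show L / Real.pi * hv * b * Sa * B = (L / Real.pi * B * hv) * (b * Sa) by ring, abs_mul,
        abs_of_nonneg (by positivity)]
    _ ≤ 1 / 3 * hv * E := by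
      rw [show L / Real.pi * B * hv * |b * Sa| = (L / Real.pi * B) * (hv * |b * Sa|) by ring,
        show 1 / 3 * hv * E = 1 / 3 * (hv * E) by ring]
      exact mul_le_mul h2 (mul_le_mul_of_nonneg_left h1 hv0) (by positivity) (by norm_num)
    _ = 1 / 3 * (hv * E) := by ring

/-- Strip piece 3: `|200 τ Sa Sb E(10−2D)/Z⁴| ≤ 0.0416 hv E`. [folklore] -/
theorem strip_q3 {τ Sa Sb D E Z hv : ℝ} (hτ0 : 0 ≤ τ) (hτ : τ ≤ 4 / 5) (hSa1 : |Sa| ≤ 1)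
    (hSb : |Sb| ≤ 13 / 50) (hE0 : 0 ≤ E) (hD0 : 0 ≤ D) (hD2 : D ≤ 5) (hZ : Z = 10 + D)
    (hhv : hv = 100 / Z ^ 2) :
    -(200 * τ * Sa * Sb * E * (10 - 2 * D) / Z ^ 4) ≤ 416 / 10000 * (hv * E) := by
  have hZ10 : 10 ≤ Z := by rw [hZ]; linarith
  have hZ0 : 0 < Z := by linarith
  have h1 : |Sa * Sb * E * (10 - 2 * D)| ≤ 1 * (13 / 50) * E * 10 := by
    rw [abs_mul, abs_mul, abs_mul, abs_of_nonneg hE0]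
    refine mul_le_mul (mul_le_mul (mul_le_mul hSa1 hSb (abs_nonneg _) zero_le_one) le_rfl hE0
      (by positivity)) ?_ (abs_nonneg _) (by positivity)
    rw [abs_le]; constructor <;> nlinarith
  have h2 : 200 * τ * |Sa * Sb * E * (10 - 2 * D)| ≤ 160 * (1 * (13 / 50) * E * 10) :=
    mul_le_mul (by linarith) h1 (abs_nonneg _) (by norm_num)
  calc -(200 * τ * Sa * Sb * E * (10 - 2 * D) / Z ^ 4)
      ≤ |200 * τ * Sa * Sb * E * (10 - 2 * D) / Z ^ 4| := neg_le_abs _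
    _ = 200 * τ * |Sa * Sb * E * (10 - 2 * D)| / Z ^ 4 := by
      rw [abs_div, abs_of_pos (by positivity : (0:ℝ) < Z ^ 4),
        show 200 * τ * Sa * Sb * E * (10 - 2 * D) = (200 * τ) * (Sa * Sb * E * (10 - 2 * D)) by ring,
        abs_mul, abs_of_nonneg (by positivity)]
    _ ≤ 160 * (1 * (13 / 50) * E * 10) / Z ^ 4 := div_le_div_of_nonneg_right h2 (by positivity)
    _ = 416 / 100 * (hv * E) * (1 / Z ^ 2) := by rw [hhv]; field_simp; ring
    _ ≤ 416 / 100 * (hv * E) * (1 / 100) := by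
      apply mul_le_mul_of_nonneg_left _ (by rw [hhv]; positivity)
      rw [div_le_div_iff₀ (by positivity) (by norm_num)]; nlinarith
    _ = 416 / 10000 * (hv * E) := by ring

/-- Strip piece 4: `|200 (L/π) Sa Sb² b/Z³| ≤ (1/25)·bSb/D`. [folklore] -/
theorem strip_q4 {L b Sa Sb D Z : ℝ} (hL : 0 < L) (hL1 : L ≤ 1) (hSa1 : |Sa| ≤ 1)
    (hSb : |Sb| ≤ 13 / 50) (hβ : 0 ≤ b * Sb) (hDpos : 0 < D) (hD2 : D ≤ 51 / 25) (hZ : Z = 10 + D) :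
    200 * (L / Real.pi) * Sa * Sb ^ 2 * b / Z ^ 3 ≤ 1 / 25 * (b * Sb / D) := by
  have hπ := Real.pi_pos
  have hπ3 : 3.14 < Real.pi := Real.pi_gt_d2
  have hZ10 : 10 < Z := by rw [hZ]; linarith
  have hZ0 : 0 < Z := by linarith
  have h1 : |Sa * Sb ^ 2 * b| ≤ 1 * ((13 / 50) * (b * Sb)) := by
    rw [show Sa * Sb ^ 2 * b = Sa * (Sb * (b * Sb)) by ring, abs_mul, abs_mul, abs_of_nonneg hβ]
    exact mul_le_mul hSa1 (mul_le_mul_of_nonneg_right hSb hβ) (by positivity) zero_le_one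
  have hLπ : L / Real.pi ≤ 32 / 100 := by rw [div_le_iff₀ hπ]; linarith
  have h2 : 200 * (L / Real.pi) * |Sa * Sb ^ 2 * b| ≤ 64 * (1 * ((13 / 50) * (b * Sb))) :=
    mul_le_mul (by linarith) h1 (abs_nonneg _) (by norm_num)
  calc 200 * (L / Real.pi) * Sa * Sb ^ 2 * b / Z ^ 3
      ≤ |200 * (L / Real.pi) * Sa * Sb ^ 2 * b / Z ^ 3| := le_abs_self _
    _ = 200 * (L / Real.pi) * |Sa * Sb ^ 2 * b| / Z ^ 3 := by
      rw [abs_div, abs_of_pos (by positivity : (0:ℝ) < Z ^ 3),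
        show 200 * (L / Real.pi) * Sa * Sb ^ 2 * b = (200 * (L / Real.pi)) * (Sa * Sb ^ 2 * b) by ring,
        abs_mul, abs_of_nonneg (by positivity)]
    _ ≤ 64 * (1 * ((13 / 50) * (b * Sb))) / Z ^ 3 := div_le_div_of_nonneg_right h2 (by positivity)
    _ = 1664 / 100 * (b * Sb / D) * (D / Z ^ 3) := by field_simp; ring
    _ ≤ 1664 / 100 * (b * Sb / D) * ((51 / 25) / 1000) := by
      apply mul_le_mul_of_nonneg_left _ (by positivity)
      rw [div_le_div_iff₀ (by positivity) (by norm_num)]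
      nlinarith [pow_le_pow_left₀ (by norm_num : (0:ℝ) ≤ 10) hZ10.le 3]
    _ ≤ 1 / 25 * (b * Sb / D) := by nlinarith [div_nonneg hβ hDpos.le]

/-- Strip piece 5: `|400 τ Sa Sb E/Z³| ≤ 0.0832 hv E`. [folklore] -/
theorem strip_q5 {τ Sa Sb D E Z hv : ℝ} (hτ0 : 0 ≤ τ) (hτ : τ ≤ 4 / 5) (hSa1 : |Sa| ≤ 1)
    (hSb : |Sb| ≤ 13 / 50) (hE0 : 0 ≤ E) (hD0 : 0 ≤ D) (hZ : Z = 10 + D) (hhv : hv = 100 / Z ^ 2) :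
    -(400 * τ * Sa * Sb * E / Z ^ 3) ≤ 832 / 10000 * (hv * E) := by
  have hZ10 : 10 ≤ Z := by rw [hZ]; linarith
  have hZ0 : 0 < Z := by linarith
  have h1 : |Sa * Sb * E| ≤ 1 * (13 / 50) * E := by
    rw [abs_mul, abs_mul, abs_of_nonneg hE0]
    exact mul_le_mul (mul_le_mul hSa1 hSb (abs_nonneg _) zero_le_one) le_rfl hE0 (by positivity)
  have h2 : 400 * τ * |Sa * Sb * E| ≤ 320 * (1 * (13 / 50) * E) :=
    mul_le_mul (by linarith) h1 (abs_nonneg _) (by norm_num)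
  calc -(400 * τ * Sa * Sb * E / Z ^ 3) ≤ |400 * τ * Sa * Sb * E / Z ^ 3| := neg_le_abs _
    _ = 400 * τ * |Sa * Sb * E| / Z ^ 3 := by
      rw [abs_div, abs_of_pos (by positivity : (0:ℝ) < Z ^ 3),
        show 400 * τ * Sa * Sb * E = (400 * τ) * (Sa * Sb * E) by ring, abs_mul,
        abs_of_nonneg (by positivity)]
    _ ≤ 320 * (1 * (13 / 50) * E) / Z ^ 3 := div_le_div_of_nonneg_right h2 (by positivity)
    _ = 832 / 1000 * (hv * E) * (1 / Z) := by rw [hhv]; field_simp; ring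
    _ ≤ 832 / 1000 * (hv * E) * (1 / 10) := by
      apply mul_le_mul_of_nonneg_left _ (by rw [hhv]; positivity)
      rw [div_le_div_iff₀ (by positivity) (by norm_num)]; nlinarith
    _ = 832 / 10000 * (hv * E) := by ring

/-- **Strip bound** (`|b| ≤ 1/4`, encoded as `B ≤ 26/25`, `|Sb| ≤ 13/50`, `b²/2 ≤ B − 1 ≤ bSb/2`):
the expanded operator `𝒜G(log D) + κ(L/π)[…]` (radial part exact, corrector part regrouped as in
`corrector_regroup`) is `≤ −(κ/3)·E` when `G′ ≥ 1/2`, `G″ ≤ 0`, `0 ≤ κ ≤ 1/10`. [folklore] -/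
theorem strip_bound {L ν c κ G₁ G₂ b A Sa B Sb D E Z hv : ℝ}
    (hL : 0 < L) (hL1 : L ≤ 1) (hν : 0 ≤ ν) (hτ : 4 * Real.pi * ν / L ≤ 4 / 5)
    (hSa : Sa ^ 2 + A ^ 2 = 1) (hSb : |Sb| ≤ 13 / 50) (hB : 1 ≤ B) (hB1 : B ≤ 26 / 25)
    (hb2 : b ^ 2 / 2 ≤ B - 1) (hB2 : B - 1 ≤ b * Sb / 2) (hβ : 0 ≤ b * Sb)
    (hD : D = B - A) (hE : E = B + A) (hDpos : 0 < D) (hZ : Z = 10 + D) (hhv : hv = 100 / Z ^ 2)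
    (hκ0 : 0 ≤ κ) (hκ : κ ≤ 1 / 10) (hG₁ : 1 / 2 ≤ G₁) (hG₂ : G₂ ≤ 0) :
    ν * c ^ 2 * (E / D) * G₂ - G₁ * (b * Sb / D) +
      κ * (hv * (-E + E * ((B - 1) * (1 + A)) / D) - L / Real.pi * hv * b * Sa * B -
        200 * (4 * Real.pi * ν / L) * Sa * Sb * E * (10 - 2 * D) / Z ^ 4 +
        200 * (L / Real.pi) * Sa * Sb ^ 2 * b / Z ^ 3 -
        400 * (4 * Real.pi * ν / L) * Sa * Sb * E / Z ^ 3) ≤ -(κ / 3) * E := by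
  have hτ0 : 0 ≤ 4 * Real.pi * ν / L := by positivity
  have hA1 : A ≤ 1 := by nlinarith [sq_nonneg Sa, sq_nonneg (A - 1)]
  have hA2 : -1 ≤ A := by nlinarith [sq_nonneg Sa, sq_nonneg (A + 1)]
  have hSa1 : |Sa| ≤ 1 := by rw [← sq_le_one_iff_abs_le_one]; nlinarith [sq_nonneg A]
  have hE0 : 0 ≤ E := by rw [hE]; linarith
  have hD2 : D ≤ 51 / 25 := by rw [hD]; linarith
  have hZ0 : 0 < Z := by rw [hZ]; linarith
  have hZ2 : Z ≤ 1204 / 100 := by rw [hZ]; linarith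
  have hv0 : 0 ≤ hv := by rw [hhv]; positivity
  have hv68 : 68 / 100 ≤ hv := by
    rw [hhv, le_div_iff₀ (by positivity)]; nlinarith
  have q1 := strip_q1 hA1 hA2 hB hB1 hD hE hDpos hZ hhv hβ hB2
  have q2 := strip_q2 hL hL1 hSa hA2 hB hB1 hE hb2 hZ0 hhv
  have q3 := strip_q3 hτ0 hτ hSa1 hSb hE0 hDpos.le (by linarith) hZ hhv
  have q4 := strip_q4 hL hL1 hSa1 hSb hβ hDpos hD2 hZ
  have q5 := strip_q5 hτ0 hτ hSa1 hSb hE0 hDpos.le hZ hhv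
  have hβD : 0 ≤ b * Sb / D := div_nonneg hβ hDpos.le
  have h0 : ν * c ^ 2 * (E / D) * G₂ ≤ 0 := mul_nonpos_of_nonneg_of_nonpos (by positivity) hG₂
  have hvE0 : 0 ≤ hv * E := mul_nonneg hv0 hE0
  have hR : hv * (-E + E * ((B - 1) * (1 + A)) / D) - L / Real.pi * hv * b * Sa * B -
        200 * (4 * Real.pi * ν / L) * Sa * Sb * E * (10 - 2 * D) / Z ^ 4 +
        200 * (L / Real.pi) * Sa * Sb ^ 2 * b / Z ^ 3 -
        400 * (4 * Real.pi * ν / L) * Sa * Sb * E / Z ^ 3 ≤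
      -(5418 / 10000) * (hv * E) + 52 / 25 * (b * Sb / D) := by linarith
  have hR' := mul_le_mul_of_nonneg_left hR hκ0
  have hvE : 68 / 100 * E ≤ hv * E := mul_le_mul_of_nonneg_right hv68 hE0
  nlinarith [mul_le_mul_of_nonneg_left hvE hκ0, mul_nonneg hκ0 hE0, mul_nonneg hκ0 hβD,
    mul_le_mul_of_nonneg_right hκ hβD, mul_le_mul_of_nonneg_right hG₁ hβD]

/-- **Registered sub-goal `stub_braidExit_farBound`** (def-free form of `corrector_far_bound`). [folklore] -/
theorem stub_braidExit_farBound : ∀ (L ν b A Sa B Sb D E Z hv : ℝ), 0 < L → L ≤ 1 → 0 ≤ ν → 4 * Real.pi * ν / L ≤ 4 / 5 → Sa ^ 2 + A ^ 2 = 1 → Sb ^ 2 = B ^ 2 - 1 → 1 ≤ B → |b| ≤ B → D = B - A → E = B + A → 0 < D → Z = 10 + D → hv = 100 / Z ^ 2 → hv * (-E + E * ((B - 1) * (1 + A)) / D) - L / Real.pi * hv * b * Sa * B - 200 * (4 * Real.pi * ν / L) * Sa * Sb * E * (10 - 2 * D) / Z ^ 4 + 200 * (L / Real.pi) * Sa *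 Sb ^ 2 * b / Z ^ 3 - 400 * (4 * Real.pi * ν / L) * Sa * Sb * E / Z ^ 3 ≤ 200 := by
  intro L ν b A Sa B Sb D E Z hv hL hL1 hν hτ hSa hSb hB hbB hD hE hDpos hZ hhv
  exact corrector_far_bound hL hL1 hν hτ hSa hSb hB hbB hD hE hDpos hZ hhv

end Summit.AnomalousDissipation.AnomalousDissipation.Theorems.MarginalStabilityChainStretchedVortexRows.BraidExit

end
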